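import Mathlib
import Literature.Analysis.FunctionSpaces.LatticeSobolevSmooth
import HarnessLib

/-!
# Interpolation with a cutoff on the lattice Sobolev scale: higher norms by lower norms plus a tail (instab g16, cell `ns-blowup`, 2026-08-27)

HONEST FRAMING (human ruling D-0035): nothing here is a claim about Navier–Stokes blow-up.
WHAT THIS IS NOT: not NS evidence — three elementary `ℝ≥0∞` inequalities for coefficient
families on `ℤ^d`, Mathlib + the tree's `LatticeSobolev*` files. No flow, set `W` or certificate
is constructed.

PURPOSE. Condition (C1) of the Wilczak–Zgliczyński setting (continuity of the field
`F = A + B(·,·)` on the set `W` of self-consistent bounds in the PHASE-SPACE norm `H²`,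
`HOME/instab/BETA2-SPEC.md` §4) for a derivative-losing field: the transport estimates of
`TransportCommutatorLattice` / `TransportSkewLattice` / `TransportLinearisedLattice` make `F`
Lipschitz from a HIGHER level `H^t` (`t = 3` for `B`, `t = 4` for `νΔ`) into `H²`; on a set with
UNIFORM `H^t`-tails this is continuity in the LOWER norm `H^s` (`s = 2`), because

  `‖c‖ₜ² = ‖𝟙_K c‖ₜ² + ‖c − 𝟙_K c‖ₜ²`                       (`eNormSq_eq_trunc_add_sub_trunc`),
  `‖𝟙_K c‖ₜ² ≤ R² ‖c‖ₛ²` if `⟨k⟩^{t−s} ≤ R` on `K`          (`eNormSq_trunc_le_mul_of_weight_le`),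
  hence `‖c‖ₜ² ≤ R² ‖c‖ₛ² + ‖c − 𝟙_K c‖ₜ²`                 (`eNormSq_le_box_interpolation`),

and for two families with `H^t`-tails `≤ τ` beyond `K`, `‖x − y‖ₜ² ≤ R² ‖x − y‖ₛ² + 4τ`
(`eNormSq_sub_le_of_uniform_tail`) — the modulus of continuity that turns an `H^t → H²` Lipschitz
bound on `W` into uniform `H² → H²` continuity on `W` (printed template: [WilczakZgliczynski2025]
§7.6.1 Thm 27, condition C1 on polynomial boxes). The `ε`–`δ` bookkeeping in the phase space is
left to the `lp` instance; here only the lattice inequalities.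

TREE SEARCH: `Lattice.trunc`, `eNormSq_trunc`, `eNormSq_sub_trunc`, `tendsto_eNormSq_sub_trunc`
(Warner 6.18 (c) density), `eNormSq_mono`, `eNormSq_sub_le` exist and are used; no cutoff
interpolation inequality in the tree (`lean search 'interpolation|trunc_le_mul'` on the lattice
files: Peter–Paul `eNormSq_add_one_le_peterPaul` only, a different inequality). Nothing restated.
-/

noncomputable section

namespace Summit.NavierStokesRegularity.FluidComputer.LatticeBoxInterpolation

open Finset
open Literature.Analysis.FunctionSpaces Literature.Analysis.FunctionSpaces.Lattice
open Literature.Analysis.FunctionSpaces.Torus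
open scoped ENNReal NNReal

variable {d : Type*} [Fintype d]
variable {V : Type*} [NormedAddCommGroup V]

/-- **Orthogonality of a truncation and its remainder in every `H^t`**:
`‖c‖ₜ² = ‖𝟙_K c‖ₜ² + ‖c − 𝟙_K c‖ₜ²` (disjoint supports, termwise). -/
theorem eNormSq_eq_trunc_add_sub_trunc (t : ℝ) (K : Finset (d → ℤ)) (c : (d → ℤ) → V) :
    eNormSq t c = eNormSq t (trunc K c) + eNormSq t (c - trunc K c) := by
  rw [eNormSq, eNormSq, eNormSq, ← ENNReal.tsum_add]
  refine tsum_congr fun k => ?_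
  by_cases hk : k ∈ K
  · simp [trunc, hk]
  · simp [trunc, hk]

/-- **The truncated part costs the weight ratio**: if `⟨k⟩ₜ ≤ R ⟨k⟩ₛ` for every `k ∈ K`,
then `‖𝟙_K c‖ₜ² ≤ R² ‖c‖ₛ²`. -/
theorem eNormSq_trunc_le_mul_of_weight_le {s t R : ℝ} {K : Finset (d → ℤ)}
    (hK : ∀ k ∈ K, sobolevWeight t k ≤ R * sobolevWeight s k) (c : (d → ℤ) → V) :
    eNormSq t (trunc K c) ≤ ENNReal.ofReal (R ^ 2) * eNormSq s c := by
  calc eNormSq t (trunc K c)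
      ≤ ENNReal.ofReal (R ^ 2) * eNormSq s (trunc K c) := by
        rw [eNormSq, eNormSq, ← ENNReal.tsum_mul_left]
        refine ENNReal.tsum_le_tsum fun k => ?_
        by_cases hk : k ∈ K
        · have h := hK k hk
          have ht : 0 ≤ sobolevWeight t k := (sobolevWeight_pos t k).le
          rw [← mul_assoc, ← ENNReal.ofReal_mul (sq_nonneg R), ← mul_pow]
          gcongr
        · simp [trunc, hk]
    _ ≤ ENNReal.ofReal (R ^ 2) * eNormSq s c := by gcongr; exact eNormSq_trunc_le s K c

/-- The weight-ratio hypothesis from a bound on `⟨k⟩^{t−s}` over `K`: `⟨k⟩ₜ = ⟨k⟩_{t−s} ⟨k⟩ₛ`. -/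
theorem weight_le_mul_of_le {s t R : ℝ} {K : Finset (d → ℤ)}
    (hK : ∀ k ∈ K, sobolevWeight (t - s) k ≤ R) : ∀ k ∈ K, sobolevWeight t k ≤ R * sobolevWeight s k :=
  fun k hk => by
    rw [show t = (t - s) + s by ring, sobolevWeight_add]
    exact mul_le_mul_of_nonneg_right (hK k hk) (sobolevWeight_pos s k).le

/-- **Interpolation with a cutoff**: if `⟨k⟩^{t−s} ≤ R` on the finite set `K`, then for
every coefficient family `c`, `‖c‖ₜ² ≤ R² ‖c‖ₛ² + ‖c − 𝟙_K c‖ₜ²`. -/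
theorem eNormSq_le_box_interpolation {s t R : ℝ} {K : Finset (d → ℤ)}
    (hK : ∀ k ∈ K, sobolevWeight (t - s) k ≤ R) (c : (d → ℤ) → V) :
    eNormSq t c ≤ ENNReal.ofReal (R ^ 2) * eNormSq s c + eNormSq t (c - trunc K c) := by
  rw [eNormSq_eq_trunc_add_sub_trunc t K c]
  gcongr
  exact eNormSq_trunc_le_mul_of_weight_le (weight_le_mul_of_le hK) c

/-- Truncation is compatible with subtraction. -/
theorem trunc_sub (K : Finset (d → ℤ)) (c c' : (d → ℤ) → V) :
    trunc K (c - c') = trunc K c - trunc K c' := by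
  funext k; by_cases hk : k ∈ K <;> simp [trunc, hk]

/-- **Modulus of continuity from uniform tails**: if `x` and `y` have `H^t`-tails beyond `K` of size
at most `τ` (`‖x − 𝟙_K x‖ₜ² ≤ τ`, `‖y − 𝟙_K y‖ₜ² ≤ τ`) and `⟨k⟩^{t−s} ≤ R` on `K`, then
`‖x − y‖ₜ² ≤ R² ‖x − y‖ₛ² + 4τ`. On a set `W` with UNIFORM `H^t`-tails (for every `τ > 0` one
finite `K` serving all of `W` — a polynomial box has them) this makes every `H^t → H²` Lipschitz
map uniformly continuous on `W` for the `H^s` distance: condition (C1) of the WZ25 setting for a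
derivative-losing field. -/
theorem eNormSq_sub_le_of_uniform_tail {s t R : ℝ} {K : Finset (d → ℤ)}
    (hK : ∀ k ∈ K, sobolevWeight (t - s) k ≤ R) {τ : ℝ≥0∞} {x y : (d → ℤ) → V}
    (hx : eNormSq t (x - trunc K x) ≤ τ) (hy : eNormSq t (y - trunc K y) ≤ τ) :
    eNormSq t (x - y) ≤ ENNReal.ofReal (R ^ 2) * eNormSq s (x - y) + 4 * τ := by
  have htail : eNormSq t ((x - y) - trunc K (x - y)) ≤ 4 * τ := by
    have hrw : (x - y) - trunc K (x - y) = (x - trunc K x) - (y - trunc K y) := by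
      rw [trunc_sub]; abel
    rw [hrw]
    calc eNormSq t ((x - trunc K x) - (y - trunc K y))
        ≤ 2 * eNormSq t (x - trunc K x) + 2 * eNormSq t (y - trunc K y) := eNormSq_sub_le t _ _
      _ ≤ 2 * τ + 2 * τ := by gcongr
      _ = 4 * τ := by ring
  exact (eNormSq_le_box_interpolation hK (x - y)).trans (by gcongr)

/-- The cube supplies the constant: on `K ⊆ {k : |k|² ≤ N}` one may take `R = (1 + N)^{(t−s)/2}`
for `s ≤ t`. -/
theorem sobolevWeight_le_of_freqNormSq_le {s t N : ℝ} (hst : s ≤ t) {k : d → ℤ}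
    (hk : freqNormSq k ≤ N) : sobolevWeight (t - s) k ≤ (1 + N) ^ ((t - s) / 2) := by
  rw [sobolevWeight]
  exact Real.rpow_le_rpow (by linarith [freqNormSq_nonneg k]) (by linarith)
    (by linarith)

end Summit.NavierStokesRegularity.FluidComputer.LatticeBoxInterpolation

end
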